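import Mathlib
import Literature.Analysis.FluidPDE.VectorCalculus
import Summits.NavierStokesRegularity.NavierStokesRegularity.Theorems.FilamentSkeletonRssClause13RClosedFormAdjoint

/-!
# Clause 13-R, route (ii′) item (a), part 6: THE ADJOINT OPERATOR — the closed-form pairing summed over the filaments and regrouped per test field
# (crux `Clause13RNearStraightL`, stmt-NavierStokesRegularity-23612; line `rate_bordered_split`, STUB R `stub_rateRow13RFlat`)

Route `FilamentSkeletonRss`, Variant A1R.  Summing the per-filament identity `…Clause13RClosedFormAdjoint.setIntegral_inner_closedForm_eq` over `j`
and exchanging the finite sums gives the pairing identity in OPERATOR FORM: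

`Σ_j ∫_{S_j} ⟪ψ_jτ, E_j(τ)⟫ dτ = Σ_k ∫_{S_k} ⟪(D^*ψ)_k(σ), Y_k(σ)⟫ dσ`,
`(D^*ψ)_k = Σ_{k'} c_{k'}•A_{kk'} + Σ_j c_k•(B_{jk} − C_{jk}) + (½φ_k + α e₃ × φ_k) + (w_k′•φ_k + w_k•φ_k′)`

(`adjoint_pairing_identity`; `E_j` the closed form of `DT·Y_j`, `A, B, C` the explicit adjoint weights of `…Clause13RPairIntegrated`, `φ_k = ψ_k − ⟪ψ_k, X_k′⟫X_k′`).
So the EXACT ANNIHILATION required by the cokernel certificate (`…Clause13RCokernelCertificate`) holds for every clamped `C¹` test family as soon as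
`(D^*ψ)_k = 0` on `S_k` for every `k` (`annihilation_of_adjoint_eq_zero`) — the target equation of census item (c).  With this file census item (a) of
memo STRUCTURE-23612-conformal-cokernel-leafhand8-g1.md is complete at the analytic level; instantiating `c_k := Γγ_k/4π`, `m_k := κ·Aa_k`,
`U_k := {‖X_k‖ < 2R_b√(Γ log Γ)}` and `E_j = deriv (fun s => T (X + sY) j τ) 0` from the clause block is `…Clause13LinearisedMapClauses` bookkeeping.

Hand `leafhand-ns-filamentskeletonrs-10-g0` (LAND-ONLY); `--supports stmt-NavierStokesRegularity-23612` helper.  HONEST FRAMING: calculus at a HYPOTHETICAL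
near-straight filament skeleton on the NEGATIVE side of a MODEL blow-up route; STUB R is NOT proved here (the cokernel element is not constructed) and
nothing in this file bears on Navier–Stokes regularity or blow-up.
-/

noncomputable section

open MeasureTheory Filter Topology Set
open scoped RealInnerProductSpace InnerProductSpace BigOperators
open Literature.Analysis.FluidPDE
open Summit.NavierStokesRegularity.NavierStokesRegularity.Theorems.Clause13RSlipAdjoint (hasCompactSupport_of_ball eq_zero_of_not_mem_ball)
open Summit.NavierStokesRegularity.NavierStokesRegularity.Theorems.Clause13RNonlocalAdjoint (continuous_setIntegral_param)
open Summit.NavierStokesRegularity.NavierStokesRegularity.Theorems.Clause13RStationContinuity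
open Summit.NavierStokesRegularity.NavierStokesRegularity.Theorems.Clause13RClosedFormAdjoint

namespace Summit.NavierStokesRegularity.NavierStokesRegularity.Theorems.Clause13RAdjointOperator
set_option linter.dupNamespace false

/-! ## §1 Continuity of the nonlocal adjoint weights `B_{jk}`, `C_{jk}` in `σ` -/

/-- The nonlocal adjoint weight `B_{jk}(σ) = ∫_{S_j} H^⊤(τ, σ) dτ` is continuous in `σ`. [folklore] -/
theorem continuous_B {S : Set ℝ} (hS : IsCompact S) {φ y X : ℝ → EuclideanSpace ℝ (Fin 3)} {m : ℝ → ℝ}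
    (hφ : Continuous φ) (hy : Continuous y) (hX : ContDiff ℝ 1 X) (hmc : Continuous m) (hmpos : ∀ σ, 0 < m σ) :
    Continuous fun σ => ∫ τ in S, ((3 * ((‖y τ - X σ‖ ^ 2 + m σ) ^ (5 / 2 : ℝ))⁻¹ * ⟪φ τ, cross (deriv X σ) (y τ - X σ)⟫) • (y τ - X σ)
        - ((‖y τ - X σ‖ ^ 2 + m σ) ^ (3 / 2 : ℝ))⁻¹ • cross (φ τ) (deriv X σ)) := by
  have hXc : Continuous X := hX.continuous
  have hX'c : Continuous (deriv X) := hX.continuous_deriv le_rfl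
  have hd2 : Continuous fun p : ℝ × ℝ => y p.1 - X p.2 := (hy.comp continuous_fst).sub (hXc.comp continuous_snd)
  have hs2 : Continuous fun p : ℝ × ℝ => ‖y p.1 - X p.2‖ ^ 2 + m p.2 := (hd2.norm.pow 2).add (hmc.comp continuous_snd)
  have hpos2 : ∀ p : ℝ × ℝ, 0 < ‖y p.1 - X p.2‖ ^ 2 + m p.2 := fun p => by have := hmpos p.2; positivity
  have hk52 : Continuous fun p : ℝ × ℝ => ((‖y p.1 - X p.2‖ ^ 2 + m p.2) ^ (5 / 2 : ℝ))⁻¹ :=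
    (hs2.rpow_const fun p => Or.inl (hpos2 p).ne').inv₀ fun p => (Real.rpow_pos_of_pos (hpos2 p) _).ne'
  have hk32 : Continuous fun p : ℝ × ℝ => ((‖y p.1 - X p.2‖ ^ 2 + m p.2) ^ (3 / 2 : ℝ))⁻¹ :=
    (hs2.rpow_const fun p => Or.inl (hpos2 p).ne').inv₀ fun p => (Real.rpow_pos_of_pos (hpos2 p) _).ne'
  have hcr2 : Continuous fun p : ℝ × ℝ => cross (deriv X p.2) (y p.1 - X p.2) :=
    (crossCLM.continuous.comp (hX'c.comp continuous_snd)).clm_apply hd2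
  have hcr3 : Continuous fun p : ℝ × ℝ => cross (φ p.1) (deriv X p.2) :=
    (crossCLM.continuous.comp (hφ.comp continuous_fst)).clm_apply (hX'c.comp continuous_snd)
  have hH : Continuous (Function.uncurry fun τ σ =>
      (3 * ((‖y τ - X σ‖ ^ 2 + m σ) ^ (5 / 2 : ℝ))⁻¹ * ⟪φ τ, cross (deriv X σ) (y τ - X σ)⟫) • (y τ - X σ)
        - ((‖y τ - X σ‖ ^ 2 + m σ) ^ (3 / 2 : ℝ))⁻¹ • cross (φ τ) (deriv X σ)) :=
    (((continuous_const.mul hk52).mul ((hφ.comp continuous_fst).inner hcr2)).smul hd2).sub (hk32.smul hcr3)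
  exact continuous_setIntegral_param hS hH

/-- The adjoint weight `C_{jk}(σ)` (from the `Y′`-term, constant core `a₀ > 0`) is continuous in `σ`. [folklore] -/
theorem continuous_C {S : Set ℝ} (hS : IsCompact S) {φ y X : ℝ → EuclideanSpace ℝ (Fin 3)} {a₀ : ℝ}
    (hφ : Continuous φ) (hy : Continuous y) (hX : ContDiff ℝ 1 X) (ha₀ : 0 < a₀) :
    Continuous fun σ => ∫ τ in S, ((3 * ⟪y τ - X σ, deriv X σ⟫ * ((‖y τ - X σ‖ ^ 2 + a₀) ^ (5 / 2 : ℝ))⁻¹) • cross (φ τ) (X σ - y τ)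
        + ((‖y τ - X σ‖ ^ 2 + a₀) ^ (3 / 2 : ℝ))⁻¹ • cross (φ τ) (deriv X σ)) := by
  have hXc : Continuous X := hX.continuous
  have hX'c : Continuous (deriv X) := hX.continuous_deriv le_rfl
  have hd2 : Continuous fun p : ℝ × ℝ => y p.1 - X p.2 := (hy.comp continuous_fst).sub (hXc.comp continuous_snd)
  have hd2' : Continuous fun p : ℝ × ℝ => X p.2 - y p.1 := (hXc.comp continuous_snd).sub (hy.comp continuous_fst)
  have hs2 : Continuous fun p : ℝ × ℝ => ‖y p.1 - X p.2‖ ^ 2 + a₀ := (hd2.norm.pow 2).add continuous_const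
  have hpos2 : ∀ p : ℝ × ℝ, 0 < ‖y p.1 - X p.2‖ ^ 2 + a₀ := fun p => by positivity
  have hk52 : Continuous fun p : ℝ × ℝ => ((‖y p.1 - X p.2‖ ^ 2 + a₀) ^ (5 / 2 : ℝ))⁻¹ :=
    (hs2.rpow_const fun p => Or.inl (hpos2 p).ne').inv₀ fun p => (Real.rpow_pos_of_pos (hpos2 p) _).ne'
  have hk32 : Continuous fun p : ℝ × ℝ => ((‖y p.1 - X p.2‖ ^ 2 + a₀) ^ (3 / 2 : ℝ))⁻¹ :=
    (hs2.rpow_const fun p => Or.inl (hpos2 p).ne').inv₀ fun p => (Real.rpow_pos_of_pos (hpos2 p) _).ne'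
  have hcr2 : Continuous fun p : ℝ × ℝ => cross (φ p.1) (X p.2 - y p.1) :=
    (crossCLM.continuous.comp (hφ.comp continuous_fst)).clm_apply hd2'
  have hcr3 : Continuous fun p : ℝ × ℝ => cross (φ p.1) (deriv X p.2) :=
    (crossCLM.continuous.comp (hφ.comp continuous_fst)).clm_apply (hX'c.comp continuous_snd)
  have hH : Continuous (Function.uncurry fun τ σ =>
      (3 * ⟪y τ - X σ, deriv X σ⟫ * ((‖y τ - X σ‖ ^ 2 + a₀) ^ (5 / 2 : ℝ))⁻¹) • cross (φ τ) (X σ - y τ)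
        + ((‖y τ - X σ‖ ^ 2 + a₀) ^ (3 / 2 : ℝ))⁻¹ • cross (φ τ) (deriv X σ)) :=
    (((continuous_const.mul (hd2.inner (hX'c.comp continuous_snd))).mul hk52).smul hcr2).add (hk32.smul hcr3)
  exact continuous_setIntegral_param hS hH

/-! ## §2 The adjoint operator -/

/-- **THE PAIRING IDENTITY IN OPERATOR FORM** `Σ_j ∫_{S_j} ⟪ψ_j, E_j⟫ = Σ_k ∫_{S_k} ⟪(D^*ψ)_k, Y_k⟫` (hypotheses as in
`…Clause13RClosedFormAdjoint.setIntegral_inner_closedForm_eq`, for all filaments at once; the test fields are clamped to their balls). [folklore] -/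
theorem adjoint_pairing_identity {N : ℕ} {ℓ Λ α m₀ c C : ℝ} {X ψ Y : Fin N → ℝ → EuclideanSpace ℝ (Fin 3)} {w : Fin N → ℝ → ℝ}
    {m : Fin N → ℝ → ℝ} {a₀ : Fin N → ℝ} {U : Fin N → Set ℝ} (cc : Fin N → ℝ)
    (hX : ∀ j, ContDiff ℝ 2 (X j)) (hX1 : ∀ k σ, ‖deriv (X k) σ‖ ≤ 1) (hc : 0 < c) (hXg : ∀ k σ, c * |σ| - C ≤ ‖X k σ‖)
    (hS : ∀ j, IsCompact {σ : ℝ | ‖X j σ‖ ≤ ℓ}) (hw : ∀ j, Differentiable ℝ (w j)) (hwΛ : ∀ j τ, |deriv (w j) τ| ≤ Λ)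
    (hψ : ∀ j, ContDiff ℝ 1 (ψ j)) (hY : ∀ k, ContDiff ℝ 1 (Y k)) (hYoff : ∀ k τ, ℓ < ‖X k τ‖ → Y k τ = 0)
    (hm₀ : 0 < m₀) (hm : ∀ k σ, m₀ ≤ m k σ) (hmc : ∀ k, Continuous (m k)) (ha₀ : ∀ k, 0 < a₀ k) (hU : ∀ k, IsOpen (U k))
    (hmU : ∀ k σ, σ ∈ U k → m k σ = a₀ k) (hYU : ∀ k, tsupport (Y k) ⊆ U k) :
    ∑ j, ∫ τ in {σ : ℝ | ‖X j σ‖ ≤ ℓ}, ⟪ψ j τ, (((∑ k, cc k • ∫ σ, ((-3 * ⟪X j τ - X k σ, Y j τ - Y k σ⟫ * ((‖X j τ - X k σ‖ ^ 2 + m k σ) ^ (5 / 2 : ℝ))⁻¹) • cross (deriv (X k) σ) (X j τ - X k σ) + ((‖X j τ - X k σ‖ ^ 2 + m k σ) ^ (3 / 2 : ℝ))⁻¹ • (cross (deriv (X k) σ) (Y j τ - Y k σ) + cross (deriv (Y k) σ) (X j τ - X k σ)))) + (1 / 2 : ℝ) • Y j τ - α • cross (EuclideanSpace.single 2 1) (Y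 j τ)) - ⟪((∑ k, cc k • ∫ σ, ((-3 * ⟪X j τ - X k σ, Y j τ - Y k σ⟫ * ((‖X j τ - X k σ‖ ^ 2 + m k σ) ^ (5 / 2 : ℝ))⁻¹) • cross (deriv (X k) σ) (X j τ - X k σ) + ((‖X j τ - X k σ‖ ^ 2 + m k σ) ^ (3 / 2 : ℝ))⁻¹ • (cross (deriv (X k) σ) (Y j τ - Y k σ) + cross (deriv (Y k) σ) (X j τ - X k σ)))) + (1 / 2 : ℝ) • Y j τ - α • cross (EuclideanSpace.single 2 1) (Y j τ)), deriv (X j) τ⟫ • deriv (X j) τ + ((w j τ * ⟪deriv (X j) τ, deriv (Y j) τ⟫) • deriv (X j) τ - w j τ • deriv (Y j) τ))⟫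
      = ∑ k, ∫ σ in {σ : ℝ | ‖X k σ‖ ≤ ℓ}, ⟪((∑ k', cc k' • (∫ u, ((-3 * ((‖X k σ - X k' u‖ ^ 2 + m k' u) ^ (5 / 2 : ℝ))⁻¹ * ⟪(ψ k σ - ⟪ψ k σ, deriv (X k) σ⟫ • deriv (X k) σ), cross (deriv (X k') u) (X k σ - X k' u)⟫) • (X k σ - X k' u) + ((‖X k σ - X k' u‖ ^ 2 + m k' u) ^ (3 / 2 : ℝ))⁻¹ • cross (ψ k σ - ⟪ψ k σ, deriv (X k) σ⟫ • deriv (X k) σ) (deriv (X k') u)))) + (∑ j, cc k • ((∫ τ in {σ : ℝ | ‖X j σ‖ ≤ ℓ}, ((3 * ((‖X j τ - X k σ‖ ^ 2 + m k σ) ^ (5 / 2 : ℝ))⁻¹ * ⟪(ψ j τ - ⟪ψ j τ, deriv (X j) τ⟫ • deriv (X j) τ), cross (deriv (X k) σ) (X j τ - X k σ)⟫) • (X j τ - X k σ) - ((‖X j τ - X k σ‖ ^ 2 + m k σ) ^ (3 / 2 : ℝ))⁻¹ • cross (ψ j τ - ⟪ψ j τ, deriv (X j) τ⟫ • deriv (X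 j) τ) (deriv (X k) σ))) - (∫ τ in {σ : ℝ | ‖X j σ‖ ≤ ℓ}, ((3 * ⟪X j τ - X k σ, deriv (X k) σ⟫ * ((‖X j τ - X k σ‖ ^ 2 + a₀ k) ^ (5 / 2 : ℝ))⁻¹) • cross (ψ j τ - ⟪ψ j τ, deriv (X j) τ⟫ • deriv (X j) τ) (X k σ - X j τ) + ((‖X j τ - X k σ‖ ^ 2 + a₀ k) ^ (3 / 2 : ℝ))⁻¹ • cross (ψ j τ - ⟪ψ j τ, deriv (X j) τ⟫ • deriv (X j) τ) (deriv (X k) σ))))) + ((1 / 2 : ℝ) • (ψ k σ - ⟪ψ k σ, deriv (X k) σ⟫ • deriv (X k) σ) + α • cross (EuclideanSpace.single 2 1) (ψ k σ - ⟪ψ k σ, deriv (X k) σ⟫ • deriv (X k) σ)) + (deriv (w k) σ • (ψ k σ - ⟪ψ k σ, deriv (X k) σ⟫ • deriv (X k) σ) + w k σ • (deriv (ψ k) σ - (⟪deriv (ψ k) σ, deriv (X k) σ⟫ + ⟪ψ k σ, deriv (deriv (X k)) σ⟫) • deriv (X k) σ - ⟪ψ k σ, deriv (X k) σ⟫ •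 deriv (deriv (X k)) σ))), Y k σ⟫ := by
  -- continuity bookkeeping
  have hX1c : ∀ j, ContDiff ℝ 1 (X j) := fun j => (hX j).of_le (by norm_num)
  have hXc : ∀ j, Continuous (X j) := fun j => (hX j).continuous
  have hX'c : ∀ j, Continuous (deriv (X j)) := fun j => (hX j).continuous_deriv (by norm_num)
  have hψc : ∀ j, Continuous (ψ j) := fun j => (hψ j).continuous
  have hYc : ∀ k, Continuous (Y k) := fun k => (hY k).continuous
  have hYcs : ∀ k, HasCompactSupport (Y k) := fun k => hasCompactSupport_of_ball (hS k) (hYoff k)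
  have hmpos : ∀ k σ, 0 < m k σ := fun k σ => hm₀.trans_le (hm k σ)
  have hφc : ∀ j, Continuous fun τ => (ψ j τ - ⟪ψ j τ, deriv (X j) τ⟫ • deriv (X j) τ) := fun j => by
    have hi : Continuous fun τ => ⟪ψ j τ, deriv (X j) τ⟫ := (hψc j).inner (hX'c j)
    exact (hψc j).sub (hi.smul (hX'c j))
  have hyS : ∀ j, ∀ τ ∈ {σ : ℝ | ‖X j σ‖ ≤ ℓ}, ‖X j τ‖ ≤ ℓ := fun j τ hτ => hτ
  -- integrability of the scalar pairing densities
  have iA : ∀ j k, IntegrableOn (fun τ => ⟪(∫ u, ((-3 * ((‖X j τ - X k u‖ ^ 2 + m k u) ^ (5 / 2 : ℝ))⁻¹ * ⟪(ψ j τ - ⟪ψ j τ, deriv (X j) τ⟫ • deriv (X j) τ), cross (deriv (X k) u) (X j τ - X k u)⟫) • (X j τ - X k u) + ((‖X j τ - X k u‖ ^ 2 + m k u) ^ (3 / 2 : ℝ))⁻¹ • cross (ψ j τ - ⟪ψ j τ, deriv (X j) τ⟫ • deriv (X j) τ) (deriv (X k) u))), Y j τ⟫) {σ : ℝ | ‖X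 j σ‖ ≤ ℓ} := fun j k =>
    integrableOn_inner_localAdj (hS j) hm₀ (hm k) (hmc k) hc (hX1c k) (hX1 k) (hXg k) (hXc j) (hφc j) (hYc j) (hyS j)
  have iB : ∀ j k, IntegrableOn (fun σ => ⟪(∫ τ in {σ : ℝ | ‖X j σ‖ ≤ ℓ}, ((3 * ((‖X j τ - X k σ‖ ^ 2 + m k σ) ^ (5 / 2 : ℝ))⁻¹ * ⟪(ψ j τ - ⟪ψ j τ, deriv (X j) τ⟫ • deriv (X j) τ), cross (deriv (X k) σ) (X j τ - X k σ)⟫) • (X j τ - X k σ) - ((‖X j τ - X k σ‖ ^ 2 + m k σ) ^ (3 / 2 : ℝ))⁻¹ • cross (ψ j τ - ⟪ψ j τ, deriv (X j) τ⟫ • deriv (X j) τ) (deriv (X k) σ))), Y k σ⟫) {σ : ℝ | ‖X k σ‖ ≤ ℓ} := fun j k =>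
    ((continuous_B (hS j) (hφc j) (hXc j) (hX1c k) (hmc k) (hmpos k)).inner (hYc k)).continuousOn.integrableOn_compact (hS k)
  have iC : ∀ j k, IntegrableOn (fun σ => ⟪(∫ τ in {σ : ℝ | ‖X j σ‖ ≤ ℓ}, ((3 * ⟪X j τ - X k σ, deriv (X k) σ⟫ * ((‖X j τ - X k σ‖ ^ 2 + a₀ k) ^ (5 / 2 : ℝ))⁻¹) • cross (ψ j τ - ⟪ψ j τ, deriv (X j) τ⟫ • deriv (X j) τ) (X k σ - X j τ) + ((‖X j τ - X k σ‖ ^ 2 + a₀ k) ^ (3 / 2 : ℝ))⁻¹ • cross (ψ j τ - ⟪ψ j τ, deriv (X j) τ⟫ • deriv (X j) τ) (deriv (X k) σ))), Y k σ⟫) {σ : ℝ | ‖X k σ‖ ≤ ℓ} := fun j k =>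
    ((continuous_C (hS j) (hφc j) (hXc j) (hX1c k) (ha₀ k)).inner (hYc k)).continuousOn.integrableOn_compact (hS k)
  have iL : ∀ k, IntegrableOn (fun σ => ⟪((1 / 2 : ℝ) • (ψ k σ - ⟪ψ k σ, deriv (X k) σ⟫ • deriv (X k) σ) + α • cross (EuclideanSpace.single 2 1) (ψ k σ - ⟪ψ k σ, deriv (X k) σ⟫ • deriv (X k) σ)), Y k σ⟫) {σ : ℝ | ‖X k σ‖ ≤ ℓ} := fun k => by
    have hl1 : Continuous fun σ => (1 / 2 : ℝ) • (ψ k σ - ⟪ψ k σ, deriv (X k) σ⟫ • deriv (X k) σ) := (hφc k).const_smul (1 / 2 : ℝ)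
    have hl2 : Continuous fun σ => α • cross (EuclideanSpace.single 2 1) (ψ k σ - ⟪ψ k σ, deriv (X k) σ⟫ • deriv (X k) σ) :=
      ((crossCLM (EuclideanSpace.single 2 1)).continuous.comp (hφc k)).const_smul α
    exact ((hl1.add hl2).inner (hYc k)).continuousOn.integrableOn_compact (hS k)
  have iS : ∀ k, IntegrableOn (fun σ => ⟪(deriv (w k) σ • (ψ k σ - ⟪ψ k σ, deriv (X k) σ⟫ • deriv (X k) σ) + w k σ • (deriv (ψ k) σ - (⟪deriv (ψ k) σ, deriv (X k) σ⟫ + ⟪ψ k σ, deriv (deriv (X k)) σ⟫) • deriv (X k) σ - ⟪ψ k σ, deriv (X k) σ⟫ • deriv (deriv (X k)) σ)), Y k σ⟫) {σ : ℝ | ‖X k σ‖ ≤ ℓ} := fun k =>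
    integrableOn_inner_slipAdj (hS k) (hX k) (hw k) (hwΛ k) (hψ k) (hYc k)
  -- whole-line integrals of the nonlocal densities are integrals over the ball of the test field
  have eB : ∀ j k, (∫ σ, ⟪(∫ τ in {σ : ℝ | ‖X j σ‖ ≤ ℓ}, ((3 * ((‖X j τ - X k σ‖ ^ 2 + m k σ) ^ (5 / 2 : ℝ))⁻¹ * ⟪(ψ j τ - ⟪ψ j τ, deriv (X j) τ⟫ • deriv (X j) τ), cross (deriv (X k) σ) (X j τ - X k σ)⟫) • (X j τ - X k σ) - ((‖X j τ - X k σ‖ ^ 2 + m k σ) ^ (3 / 2 : ℝ))⁻¹ • cross (ψ j τ - ⟪ψ j τ, deriv (X j) τ⟫ • deriv (X j) τ) (deriv (X k) σ))), Y k σ⟫) = (∫ σ in {σ : ℝ | ‖X k σ‖ ≤ ℓ}, ⟪(∫ τ in {σ : ℝ | ‖X j σ‖ ≤ ℓ}, ((3 * ((‖X j τ - X k σ‖ ^ 2 + m k σ) ^ (5 / 2 : ℝ))⁻¹ * ⟪(ψ j τ - ⟪ψ j τ, deriv (X j) τ⟫ • deriv (X j) τ), cross (deriv (X k) σ) (X j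 τ - X k σ)⟫) • (X j τ - X k σ) - ((‖X j τ - X k σ‖ ^ 2 + m k σ) ^ (3 / 2 : ℝ))⁻¹ • cross (ψ j τ - ⟪ψ j τ, deriv (X j) τ⟫ • deriv (X j) τ) (deriv (X k) σ))), Y k σ⟫) := fun j k =>
    (setIntegral_eq_integral_of_forall_compl_eq_zero fun σ hσ => by
      rw [eq_zero_of_not_mem_ball (hYoff k) hσ, inner_zero_right]).symm
  have eC : ∀ j k, (∫ σ, ⟪(∫ τ in {σ : ℝ | ‖X j σ‖ ≤ ℓ}, ((3 * ⟪X j τ - X k σ, deriv (X k) σ⟫ * ((‖X j τ - X k σ‖ ^ 2 + a₀ k) ^ (5 / 2 : ℝ))⁻¹) • cross (ψ j τ - ⟪ψ j τ, deriv (X j) τ⟫ • deriv (X j) τ) (X k σ - X j τ) + ((‖X j τ - X k σ‖ ^ 2 + a₀ k) ^ (3 / 2 : ℝ))⁻¹ • cross (ψ j τ - ⟪ψ j τ, deriv (X j) τ⟫ • deriv (X j) τ) (deriv (X k) σ))), Y k σ⟫) = (∫ σ in {σ : ℝ | ‖X k σ‖ ≤ ℓ}, ⟪(∫ τ in {σ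 : ℝ | ‖X j σ‖ ≤ ℓ}, ((3 * ⟪X j τ - X k σ, deriv (X k) σ⟫ * ((‖X j τ - X k σ‖ ^ 2 + a₀ k) ^ (5 / 2 : ℝ))⁻¹) • cross (ψ j τ - ⟪ψ j τ, deriv (X j) τ⟫ • deriv (X j) τ) (X k σ - X j τ) + ((‖X j τ - X k σ‖ ^ 2 + a₀ k) ^ (3 / 2 : ℝ))⁻¹ • cross (ψ j τ - ⟪ψ j τ, deriv (X j) τ⟫ • deriv (X j) τ) (deriv (X k) σ))), Y k σ⟫) := fun j k =>
    (setIntegral_eq_integral_of_forall_compl_eq_zero fun σ hσ => by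
      rw [eq_zero_of_not_mem_ball (hYoff k) hσ, inner_zero_right]).symm
  -- Step 1: the per-filament identity, with the nonlocal integrals restricted to the balls
  have h1 : ∀ j, ∫ τ in {σ : ℝ | ‖X j σ‖ ≤ ℓ}, ⟪ψ j τ, (((∑ k, cc k • ∫ σ, ((-3 * ⟪X j τ - X k σ, Y j τ - Y k σ⟫ * ((‖X j τ - X k σ‖ ^ 2 + m k σ) ^ (5 / 2 : ℝ))⁻¹) • cross (deriv (X k) σ) (X j τ - X k σ) + ((‖X j τ - X k σ‖ ^ 2 + m k σ) ^ (3 / 2 : ℝ))⁻¹ • (cross (deriv (X k) σ) (Y j τ - Y k σ) + cross (deriv (Y k) σ) (X j τ - X k σ)))) + (1 / 2 : ℝ) • Y j τ - α • cross (EuclideanSpace.single 2 1) (Y j τ)) - ⟪((∑ k, cc k • ∫ σ, ((-3 * ⟪X j τ - X k σ, Y j τ - Y k σ⟫ * ((‖X j τ - X k σ‖ ^ 2 + m k σ) ^ (5 / 2 : ℝ))⁻¹) • cross (deriv (X k) σ) (X j τ - X k σ) + ((‖X j τ - X k σ‖ ^ 2 + m k σ) ^ (3 / 2 : ℝ))⁻¹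 • (cross (deriv (X k) σ) (Y j τ - Y k σ) + cross (deriv (Y k) σ) (X j τ - X k σ)))) + (1 / 2 : ℝ) • Y j τ - α • cross (EuclideanSpace.single 2 1) (Y j τ)), deriv (X j) τ⟫ • deriv (X j) τ + ((w j τ * ⟪deriv (X j) τ, deriv (Y j) τ⟫) • deriv (X j) τ - w j τ • deriv (Y j) τ))⟫
      = (∑ k, cc k * ((∫ τ in {σ : ℝ | ‖X j σ‖ ≤ ℓ}, ⟪(∫ u, ((-3 * ((‖X j τ - X k u‖ ^ 2 + m k u) ^ (5 / 2 : ℝ))⁻¹ * ⟪(ψ j τ - ⟪ψ j τ, deriv (X j) τ⟫ • deriv (X j) τ), cross (deriv (X k) u) (X j τ - X k u)⟫) • (X j τ - X k u) + ((‖X j τ - X k u‖ ^ 2 + m k u) ^ (3 / 2 : ℝ))⁻¹ • cross (ψ j τ - ⟪ψ j τ, deriv (X j) τ⟫ • deriv (X j) τ) (deriv (X k) u))), Y j τ⟫) + (∫ σ in {σ : ℝ | ‖X k σ‖ ≤ ℓ}, ⟪(∫ τ in {σ : ℝ | ‖X j σ‖ ≤ ℓ}, ((3 * ((‖X j τ -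 X k σ‖ ^ 2 + m k σ) ^ (5 / 2 : ℝ))⁻¹ * ⟪(ψ j τ - ⟪ψ j τ, deriv (X j) τ⟫ • deriv (X j) τ), cross (deriv (X k) σ) (X j τ - X k σ)⟫) • (X j τ - X k σ) - ((‖X j τ - X k σ‖ ^ 2 + m k σ) ^ (3 / 2 : ℝ))⁻¹ • cross (ψ j τ - ⟪ψ j τ, deriv (X j) τ⟫ • deriv (X j) τ) (deriv (X k) σ))), Y k σ⟫) - (∫ σ in {σ : ℝ | ‖X k σ‖ ≤ ℓ}, ⟪(∫ τ in {σ : ℝ | ‖X j σ‖ ≤ ℓ}, ((3 * ⟪X j τ - X k σ, deriv (X k) σ⟫ * ((‖X j τ - X k σ‖ ^ 2 + a₀ k) ^ (5 / 2 : ℝ))⁻¹) • cross (ψ j τ - ⟪ψ j τ, deriv (X j) τ⟫ • deriv (X j) τ) (X k σ - X j τ) + ((‖X j τ - X k σ‖ ^ 2 + a₀ k) ^ (3 / 2 : ℝ))⁻¹ • cross (ψ j τ - ⟪ψ j τ, deriv (X j) τ⟫ • deriv (X j) τ) (deriv (X k) σ))), Y k σ⟫))) + (∫ τ in {σ : ℝ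 | ‖X j σ‖ ≤ ℓ}, ⟪((1 / 2 : ℝ) • (ψ j τ - ⟪ψ j τ, deriv (X j) τ⟫ • deriv (X j) τ) + α • cross (EuclideanSpace.single 2 1) (ψ j τ - ⟪ψ j τ, deriv (X j) τ⟫ • deriv (X j) τ)), Y j τ⟫) + (∫ τ in {σ : ℝ | ‖X j σ‖ ≤ ℓ}, ⟪(deriv (w j) τ • (ψ j τ - ⟪ψ j τ, deriv (X j) τ⟫ • deriv (X j) τ) + w j τ • (deriv (ψ j) τ - (⟪deriv (ψ j) τ, deriv (X j) τ⟫ + ⟪ψ j τ, deriv (deriv (X j)) τ⟫) • deriv (X j) τ - ⟪ψ j τ, deriv (X j) τ⟫ • deriv (deriv (X j)) τ)), Y j τ⟫) := by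
    intro j
    rw [setIntegral_inner_closedForm_eq cc (hX j) (hS j) (hw j) (hwΛ j) (hψ j) (hY j) (hYoff j) hm₀ hm hmc ha₀ hU hmU hc hX1c hX1 hXg
      hY hYcs hYU]
    congr 1; congr 1
    refine Finset.sum_congr rfl fun k _ => ?_
    rw [eB j k, eC j k]
  rw [Finset.sum_congr rfl fun j _ => h1 j]
  -- Step 2: the right-hand side, split into the four groups
  have h2 : ∀ k, ∫ σ in {σ : ℝ | ‖X k σ‖ ≤ ℓ}, ⟪((∑ k', cc k' • (∫ u, ((-3 * ((‖X k σ - X k' u‖ ^ 2 + m k' u) ^ (5 / 2 : ℝ))⁻¹ * ⟪(ψ k σ - ⟪ψ k σ, deriv (X k) σ⟫ • deriv (X k) σ), cross (deriv (X k') u) (X k σ - X k' u)⟫) • (X k σ - X k' u) + ((‖X k σ - X k' u‖ ^ 2 + m k' u) ^ (3 / 2 : ℝ))⁻¹ • cross (ψ k σ - ⟪ψ k σ, deriv (X k) σ⟫ • deriv (X k) σ) (deriv (X k') u)))) + (∑ j, cc k • ((∫ τ in {σ : ℝ | ‖X j σ‖ ≤ ℓ}, ((3 * ((‖X j τ - X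 k σ‖ ^ 2 + m k σ) ^ (5 / 2 : ℝ))⁻¹ * ⟪(ψ j τ - ⟪ψ j τ, deriv (X j) τ⟫ • deriv (X j) τ), cross (deriv (X k) σ) (X j τ - X k σ)⟫) • (X j τ - X k σ) - ((‖X j τ - X k σ‖ ^ 2 + m k σ) ^ (3 / 2 : ℝ))⁻¹ • cross (ψ j τ - ⟪ψ j τ, deriv (X j) τ⟫ • deriv (X j) τ) (deriv (X k) σ))) - (∫ τ in {σ : ℝ | ‖X j σ‖ ≤ ℓ}, ((3 * ⟪X j τ - X k σ, deriv (X k) σ⟫ * ((‖X j τ - X k σ‖ ^ 2 + a₀ k) ^ (5 / 2 : ℝ))⁻¹) • cross (ψ j τ - ⟪ψ j τ, deriv (X j) τ⟫ • deriv (X j) τ) (X k σ - X j τ) + ((‖X j τ - X k σ‖ ^ 2 + a₀ k) ^ (3 / 2 : ℝ))⁻¹ • cross (ψ j τ - ⟪ψ j τ, deriv (X j) τ⟫ • deriv (X j) τ) (deriv (X k) σ))))) + ((1 / 2 : ℝ) • (ψ k σ - ⟪ψ k σ, deriv (X k) σ⟫ • deriv (X k) σ) + α • cross (EuclideanSpace.single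 2 1) (ψ k σ - ⟪ψ k σ, deriv (X k) σ⟫ • deriv (X k) σ)) + (deriv (w k) σ • (ψ k σ - ⟪ψ k σ, deriv (X k) σ⟫ • deriv (X k) σ) + w k σ • (deriv (ψ k) σ - (⟪deriv (ψ k) σ, deriv (X k) σ⟫ + ⟪ψ k σ, deriv (deriv (X k)) σ⟫) • deriv (X k) σ - ⟪ψ k σ, deriv (X k) σ⟫ • deriv (deriv (X k)) σ))), Y k σ⟫
      = (∑ k', cc k' * (∫ τ in {σ : ℝ | ‖X k σ‖ ≤ ℓ}, ⟪(∫ u, ((-3 * ((‖X k τ - X k' u‖ ^ 2 + m k' u) ^ (5 / 2 : ℝ))⁻¹ * ⟪(ψ k τ - ⟪ψ k τ, deriv (X k) τ⟫ • deriv (X k) τ), cross (deriv (X k') u) (X k τ - X k' u)⟫) • (X k τ - X k' u) + ((‖X k τ - X k' u‖ ^ 2 + m k' u) ^ (3 / 2 : ℝ))⁻¹ • cross (ψ k τ - ⟪ψ k τ, deriv (X k) τ⟫ • deriv (X k) τ) (deriv (X k') u))), Y k τ⟫)) + (∑ j, cc k * ((∫ σ in {σ : ℝ | ‖X k σ‖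 ≤ ℓ}, ⟪(∫ τ in {σ : ℝ | ‖X j σ‖ ≤ ℓ}, ((3 * ((‖X j τ - X k σ‖ ^ 2 + m k σ) ^ (5 / 2 : ℝ))⁻¹ * ⟪(ψ j τ - ⟪ψ j τ, deriv (X j) τ⟫ • deriv (X j) τ), cross (deriv (X k) σ) (X j τ - X k σ)⟫) • (X j τ - X k σ) - ((‖X j τ - X k σ‖ ^ 2 + m k σ) ^ (3 / 2 : ℝ))⁻¹ • cross (ψ j τ - ⟪ψ j τ, deriv (X j) τ⟫ • deriv (X j) τ) (deriv (X k) σ))), Y k σ⟫) - (∫ σ in {σ : ℝ | ‖X k σ‖ ≤ ℓ}, ⟪(∫ τ in {σ : ℝ | ‖X j σ‖ ≤ ℓ}, ((3 * ⟪X j τ - X k σ, deriv (X k) σ⟫ * ((‖X j τ - X k σ‖ ^ 2 + a₀ k) ^ (5 / 2 : ℝ))⁻¹) • cross (ψ j τ - ⟪ψ j τ, deriv (X j) τ⟫ • deriv (X j) τ) (X k σ - X j τ) + ((‖X j τ - X k σ‖ ^ 2 + a₀ k) ^ (3 / 2 : ℝ))⁻¹ • cross (ψ j τ - ⟪ψ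 j τ, deriv (X j) τ⟫ • deriv (X j) τ) (deriv (X k) σ))), Y k σ⟫))) + (∫ τ in {σ : ℝ | ‖X k σ‖ ≤ ℓ}, ⟪((1 / 2 : ℝ) • (ψ k τ - ⟪ψ k τ, deriv (X k) τ⟫ • deriv (X k) τ) + α • cross (EuclideanSpace.single 2 1) (ψ k τ - ⟪ψ k τ, deriv (X k) τ⟫ • deriv (X k) τ)), Y k τ⟫) + (∫ τ in {σ : ℝ | ‖X k σ‖ ≤ ℓ}, ⟪(deriv (w k) τ • (ψ k τ - ⟪ψ k τ, deriv (X k) τ⟫ • deriv (X k) τ) + w k τ • (deriv (ψ k) τ - (⟪deriv (ψ k) τ, deriv (X k) τ⟫ + ⟪ψ k τ, deriv (deriv (X k)) τ⟫) • deriv (X k) τ - ⟪ψ k τ, deriv (X k) τ⟫ • deriv (deriv (X k)) τ)), Y k τ⟫) := by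
    intro k
    have iA' : ∀ k', IntegrableOn (fun σ => cc k' * ⟪(∫ u, ((-3 * ((‖X k σ - X k' u‖ ^ 2 + m k' u) ^ (5 / 2 : ℝ))⁻¹ * ⟪(ψ k σ - ⟪ψ k σ, deriv (X k) σ⟫ • deriv (X k) σ), cross (deriv (X k') u) (X k σ - X k' u)⟫) • (X k σ - X k' u) + ((‖X k σ - X k' u‖ ^ 2 + m k' u) ^ (3 / 2 : ℝ))⁻¹ • cross (ψ k σ - ⟪ψ k σ, deriv (X k) σ⟫ • deriv (X k) σ) (deriv (X k') u))), Y k σ⟫) {σ : ℝ | ‖X k σ‖ ≤ ℓ} := fun k' => (iA k k').const_mul _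
    have iAs : IntegrableOn (fun σ => ∑ k', cc k' * ⟪(∫ u, ((-3 * ((‖X k σ - X k' u‖ ^ 2 + m k' u) ^ (5 / 2 : ℝ))⁻¹ * ⟪(ψ k σ - ⟪ψ k σ, deriv (X k) σ⟫ • deriv (X k) σ), cross (deriv (X k') u) (X k σ - X k' u)⟫) • (X k σ - X k' u) + ((‖X k σ - X k' u‖ ^ 2 + m k' u) ^ (3 / 2 : ℝ))⁻¹ • cross (ψ k σ - ⟪ψ k σ, deriv (X k) σ⟫ • deriv (X k) σ) (deriv (X k') u))), Y k σ⟫) {σ : ℝ | ‖X k σ‖ ≤ ℓ} :=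
      integrable_finsetSum (μ := volume.restrict {σ : ℝ | ‖X k σ‖ ≤ ℓ}) Finset.univ fun k' _ => iA' k'
    have iBC' : ∀ j, IntegrableOn (fun σ => cc k * (⟪(∫ τ in {σ : ℝ | ‖X j σ‖ ≤ ℓ}, ((3 * ((‖X j τ - X k σ‖ ^ 2 + m k σ) ^ (5 / 2 : ℝ))⁻¹ * ⟪(ψ j τ - ⟪ψ j τ, deriv (X j) τ⟫ • deriv (X j) τ), cross (deriv (X k) σ) (X j τ - X k σ)⟫) • (X j τ - X k σ) - ((‖X j τ - X k σ‖ ^ 2 + m k σ) ^ (3 / 2 : ℝ))⁻¹ • cross (ψ j τ - ⟪ψ j τ, deriv (X j) τ⟫ • deriv (X j) τ) (deriv (X k) σ))), Y k σ⟫ - ⟪(∫ τ in {σ : ℝ | ‖X j σ‖ ≤ ℓ}, ((3 * ⟪X j τ - X k σ, deriv (X k) σ⟫ * ((‖X j τ - X k σ‖ ^ 2 + a₀ k) ^ (5 / 2 : ℝ))⁻¹) • cross (ψ j τ - ⟪ψ j τ, deriv (X j) τ⟫ • deriv (X j) τ) (X k σ - X j τ) + ((‖X j τ - X k σ‖ ^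 2 + a₀ k) ^ (3 / 2 : ℝ))⁻¹ • cross (ψ j τ - ⟪ψ j τ, deriv (X j) τ⟫ • deriv (X j) τ) (deriv (X k) σ))), Y k σ⟫)) {σ : ℝ | ‖X k σ‖ ≤ ℓ} :=
      fun j => ((iB j k).sub (iC j k)).const_mul _
    have iBCs : IntegrableOn (fun σ => ∑ j, cc k * (⟪(∫ τ in {σ : ℝ | ‖X j σ‖ ≤ ℓ}, ((3 * ((‖X j τ - X k σ‖ ^ 2 + m k σ) ^ (5 / 2 : ℝ))⁻¹ * ⟪(ψ j τ - ⟪ψ j τ, deriv (X j) τ⟫ • deriv (X j) τ), cross (deriv (X k) σ) (X j τ - X k σ)⟫) • (X j τ - X k σ) - ((‖X j τ - X k σ‖ ^ 2 + m k σ) ^ (3 / 2 : ℝ))⁻¹ • cross (ψ j τ - ⟪ψ j τ, deriv (X j) τ⟫ • deriv (X j) τ) (deriv (X k) σ))), Y k σ⟫ - ⟪(∫ τ in {σ : ℝ | ‖X j σ‖ ≤ ℓ}, ((3 * ⟪X j τ - X k σ, deriv (X k) σ⟫ * ((‖X j τ - X k σ‖ ^ 2 + a₀ k) ^ (5 / 2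 : ℝ))⁻¹) • cross (ψ j τ - ⟪ψ j τ, deriv (X j) τ⟫ • deriv (X j) τ) (X k σ - X j τ) + ((‖X j τ - X k σ‖ ^ 2 + a₀ k) ^ (3 / 2 : ℝ))⁻¹ • cross (ψ j τ - ⟪ψ j τ, deriv (X j) τ⟫ • deriv (X j) τ) (deriv (X k) σ))), Y k σ⟫)) {σ : ℝ | ‖X k σ‖ ≤ ℓ} :=
      integrable_finsetSum (μ := volume.restrict {σ : ℝ | ‖X k σ‖ ≤ ℓ}) Finset.univ fun j _ => iBC' j
    -- pointwise: distribute the inner product over the four groups and the finite sums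
    have hpt : ∀ σ, ⟪((∑ k', cc k' • (∫ u, ((-3 * ((‖X k σ - X k' u‖ ^ 2 + m k' u) ^ (5 / 2 : ℝ))⁻¹ * ⟪(ψ k σ - ⟪ψ k σ, deriv (X k) σ⟫ • deriv (X k) σ), cross (deriv (X k') u) (X k σ - X k' u)⟫) • (X k σ - X k' u) + ((‖X k σ - X k' u‖ ^ 2 + m k' u) ^ (3 / 2 : ℝ))⁻¹ • cross (ψ k σ - ⟪ψ k σ, deriv (X k) σ⟫ • deriv (X k) σ) (deriv (X k') u)))) + (∑ j, cc k • ((∫ τ in {σ : ℝ | ‖X j σ‖ ≤ ℓ}, ((3 * ((‖X j τ - X k σ‖ ^ 2 + m k σ) ^ (5 / 2 : ℝ))⁻¹ * ⟪(ψ j τ - ⟪ψ j τ, deriv (X j) τ⟫ • deriv (X j) τ), cross (deriv (X k) σ) (X j τ - X k σ)⟫) • (X j τ - X k σ) - ((‖X j τ - X k σ‖ ^ 2 + m k σ) ^ (3 / 2 : ℝ))⁻¹ • cross (ψ j τ - ⟪ψ j τ, deriv (X j) τ⟫ • deriv (X j) τ) (deriv (X k) σ))) - (∫ τ in {σ : ℝ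 | ‖X j σ‖ ≤ ℓ}, ((3 * ⟪X j τ - X k σ, deriv (X k) σ⟫ * ((‖X j τ - X k σ‖ ^ 2 + a₀ k) ^ (5 / 2 : ℝ))⁻¹) • cross (ψ j τ - ⟪ψ j τ, deriv (X j) τ⟫ • deriv (X j) τ) (X k σ - X j τ) + ((‖X j τ - X k σ‖ ^ 2 + a₀ k) ^ (3 / 2 : ℝ))⁻¹ • cross (ψ j τ - ⟪ψ j τ, deriv (X j) τ⟫ • deriv (X j) τ) (deriv (X k) σ))))) + ((1 / 2 : ℝ) • (ψ k σ - ⟪ψ k σ, deriv (X k) σ⟫ • deriv (X k) σ) + α • cross (EuclideanSpace.single 2 1) (ψ k σ - ⟪ψ k σ, deriv (X k) σ⟫ • deriv (X k) σ)) + (deriv (w k) σ • (ψ k σ - ⟪ψ k σ, deriv (X k) σ⟫ • deriv (X k) σ) + w k σ • (deriv (ψ k) σ - (⟪deriv (ψ k) σ, deriv (X k) σ⟫ + ⟪ψ k σ, deriv (deriv (X k)) σ⟫) • deriv (X k) σ - ⟪ψ k σ, deriv (X k) σ⟫ • deriv (deriv (X k)) σ))), Y k σ⟫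
        = (∑ k', cc k' * ⟪(∫ u, ((-3 * ((‖X k σ - X k' u‖ ^ 2 + m k' u) ^ (5 / 2 : ℝ))⁻¹ * ⟪(ψ k σ - ⟪ψ k σ, deriv (X k) σ⟫ • deriv (X k) σ), cross (deriv (X k') u) (X k σ - X k' u)⟫) • (X k σ - X k' u) + ((‖X k σ - X k' u‖ ^ 2 + m k' u) ^ (3 / 2 : ℝ))⁻¹ • cross (ψ k σ - ⟪ψ k σ, deriv (X k) σ⟫ • deriv (X k) σ) (deriv (X k') u))), Y k σ⟫) + (∑ j, cc k * (⟪(∫ τ in {σ : ℝ | ‖X j σ‖ ≤ ℓ}, ((3 * ((‖X j τ - X k σ‖ ^ 2 + m k σ) ^ (5 / 2 : ℝ))⁻¹ * ⟪(ψ j τ - ⟪ψ j τ, deriv (X j) τ⟫ • deriv (X j) τ), cross (deriv (X k) σ) (X j τ - X k σ)⟫) • (X j τ - X k σ) - ((‖X j τ - X k σ‖ ^ 2 + m k σ) ^ (3 / 2 : ℝ))⁻¹ • cross (ψ j τ - ⟪ψ j τ, deriv (X j) τ⟫ • deriv (X j) τ) (deriv (X k) σ))), Y k σ⟫ - ⟪(∫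 τ in {σ : ℝ | ‖X j σ‖ ≤ ℓ}, ((3 * ⟪X j τ - X k σ, deriv (X k) σ⟫ * ((‖X j τ - X k σ‖ ^ 2 + a₀ k) ^ (5 / 2 : ℝ))⁻¹) • cross (ψ j τ - ⟪ψ j τ, deriv (X j) τ⟫ • deriv (X j) τ) (X k σ - X j τ) + ((‖X j τ - X k σ‖ ^ 2 + a₀ k) ^ (3 / 2 : ℝ))⁻¹ • cross (ψ j τ - ⟪ψ j τ, deriv (X j) τ⟫ • deriv (X j) τ) (deriv (X k) σ))), Y k σ⟫))
          + ⟪((1 / 2 : ℝ) • (ψ k σ - ⟪ψ k σ, deriv (X k) σ⟫ • deriv (X k) σ) + α • cross (EuclideanSpace.single 2 1) (ψ k σ - ⟪ψ k σ, deriv (X k) σ⟫ • deriv (X k) σ)), Y k σ⟫ + ⟪(deriv (w k) σ • (ψ k σ - ⟪ψ k σ, deriv (X k) σ⟫ • deriv (X k) σ) + w k σ • (deriv (ψ k) σ - (⟪deriv (ψ k) σ, deriv (X k) σ⟫ + ⟪ψ k σ, deriv (deriv (X k)) σ⟫) • deriv (X k) σ - ⟪ψ k σ, deriv (X k) σ⟫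 • deriv (deriv (X k)) σ)), Y k σ⟫ := by
      intro σ
      rw [inner_add_left, inner_add_left, inner_add_left, sum_inner, sum_inner]
      congr 1; congr 1; congr 1
      · exact Finset.sum_congr rfl fun k' _ => by rw [inner_smul_left]; rfl
      · exact Finset.sum_congr rfl fun j _ => by rw [inner_smul_left, inner_sub_left]; rfl
    rw [integral_congr_ae (μ := volume.restrict {σ : ℝ | ‖X k σ‖ ≤ ℓ}) (Eventually.of_forall fun σ => hpt σ)]
    have i12 : IntegrableOn (fun σ => (∑ k', cc k' * ⟪(∫ u, ((-3 * ((‖X k σ - X k' u‖ ^ 2 + m k' u) ^ (5 / 2 : ℝ))⁻¹ * ⟪(ψ k σ - ⟪ψ k σ, deriv (X k) σ⟫ • deriv (X k) σ), cross (deriv (X k') u) (X k σ - X k' u)⟫) • (X k σ - X k' u) + ((‖X k σ - X k' u‖ ^ 2 + m k' u) ^ (3 / 2 : ℝ))⁻¹ • cross (ψ k σ - ⟪ψ k σ, deriv (X k) σ⟫ • deriv (X k) σ) (deriv (X k') u))), Y k σ⟫)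
        + (∑ j, cc k * (⟪(∫ τ in {σ : ℝ | ‖X j σ‖ ≤ ℓ}, ((3 * ((‖X j τ - X k σ‖ ^ 2 + m k σ) ^ (5 / 2 : ℝ))⁻¹ * ⟪(ψ j τ - ⟪ψ j τ, deriv (X j) τ⟫ • deriv (X j) τ), cross (deriv (X k) σ) (X j τ - X k σ)⟫) • (X j τ - X k σ) - ((‖X j τ - X k σ‖ ^ 2 + m k σ) ^ (3 / 2 : ℝ))⁻¹ • cross (ψ j τ - ⟪ψ j τ, deriv (X j) τ⟫ • deriv (X j) τ) (deriv (X k) σ))), Y k σ⟫ - ⟪(∫ τ in {σ : ℝ | ‖X j σ‖ ≤ ℓ}, ((3 * ⟪X j τ - X k σ, deriv (X k) σ⟫ * ((‖X j τ - X k σ‖ ^ 2 + a₀ k) ^ (5 / 2 : ℝ))⁻¹) • cross (ψ j τ - ⟪ψ j τ, deriv (X j) τ⟫ • deriv (X j) τ) (X k σ - X j τ) + ((‖X j τ - X k σ‖ ^ 2 + a₀ k) ^ (3 / 2 : ℝ))⁻¹ • cross (ψ j τ - ⟪ψ j τ, deriv (X j) τ⟫ • deriv (X j) τ) (deriv (X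 k) σ))), Y k σ⟫))) {σ : ℝ | ‖X k σ‖ ≤ ℓ} := iAs.add iBCs
    have i123 : IntegrableOn (fun σ => (∑ k', cc k' * ⟪(∫ u, ((-3 * ((‖X k σ - X k' u‖ ^ 2 + m k' u) ^ (5 / 2 : ℝ))⁻¹ * ⟪(ψ k σ - ⟪ψ k σ, deriv (X k) σ⟫ • deriv (X k) σ), cross (deriv (X k') u) (X k σ - X k' u)⟫) • (X k σ - X k' u) + ((‖X k σ - X k' u‖ ^ 2 + m k' u) ^ (3 / 2 : ℝ))⁻¹ • cross (ψ k σ - ⟪ψ k σ, deriv (X k) σ⟫ • deriv (X k) σ) (deriv (X k') u))), Y k σ⟫)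
        + (∑ j, cc k * (⟪(∫ τ in {σ : ℝ | ‖X j σ‖ ≤ ℓ}, ((3 * ((‖X j τ - X k σ‖ ^ 2 + m k σ) ^ (5 / 2 : ℝ))⁻¹ * ⟪(ψ j τ - ⟪ψ j τ, deriv (X j) τ⟫ • deriv (X j) τ), cross (deriv (X k) σ) (X j τ - X k σ)⟫) • (X j τ - X k σ) - ((‖X j τ - X k σ‖ ^ 2 + m k σ) ^ (3 / 2 : ℝ))⁻¹ • cross (ψ j τ - ⟪ψ j τ, deriv (X j) τ⟫ • deriv (X j) τ) (deriv (X k) σ))), Y k σ⟫ - ⟪(∫ τ in {σ : ℝ | ‖X j σ‖ ≤ ℓ}, ((3 * ⟪X j τ - X k σ, deriv (X k) σ⟫ * ((‖X j τ - X k σ‖ ^ 2 + a₀ k) ^ (5 / 2 : ℝ))⁻¹) • cross (ψ j τ - ⟪ψ j τ, deriv (X j) τ⟫ • deriv (X j) τ) (X k σ - X j τ) + ((‖X j τ - X k σ‖ ^ 2 + a₀ k) ^ (3 / 2 : ℝ))⁻¹ • cross (ψ j τ - ⟪ψ j τ, deriv (X j) τ⟫ • deriv (X j) τ) (deriv (X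 k) σ))), Y k σ⟫)) + ⟪((1 / 2 : ℝ) • (ψ k σ - ⟪ψ k σ, deriv (X k) σ⟫ • deriv (X k) σ) + α • cross (EuclideanSpace.single 2 1) (ψ k σ - ⟪ψ k σ, deriv (X k) σ⟫ • deriv (X k) σ)), Y k σ⟫) {σ : ℝ | ‖X k σ‖ ≤ ℓ} := i12.add (iL k)
    rw [integral_add i123 (iS k), integral_add i12 (iL k), integral_add iAs iBCs,
      integral_finsetSum _ fun k' _ => iA' k', integral_finsetSum _ fun j _ => iBC' j]
    congr 1; congr 1; congr 1
    · exact Finset.sum_congr rfl fun k' _ => integral_const_mul _ _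
    · refine Finset.sum_congr rfl fun j _ => ?_
      rw [integral_const_mul, integral_sub (iB j k) (iC j k)]
  rw [Finset.sum_congr rfl fun k _ => h2 k]
  -- Step 3: exchange the finite sums in the nonlocal group
  simp only [Finset.sum_add_distrib, mul_add, mul_sub, Finset.sum_sub_distrib]
  have hcomm1 : (∑ j, ∑ k, cc k * (∫ σ in {σ : ℝ | ‖X k σ‖ ≤ ℓ}, ⟪(∫ τ in {σ : ℝ | ‖X j σ‖ ≤ ℓ}, ((3 * ((‖X j τ - X k σ‖ ^ 2 + m k σ) ^ (5 / 2 : ℝ))⁻¹ * ⟪(ψ j τ - ⟪ψ j τ, deriv (X j) τ⟫ • deriv (X j) τ), cross (deriv (X k) σ) (X j τ - X k σ)⟫) • (X j τ - X k σ) - ((‖X j τ - X k σ‖ ^ 2 + m k σ) ^ (3 / 2 : ℝ))⁻¹ • cross (ψ j τ - ⟪ψ j τ, deriv (X j) τ⟫ • deriv (X j) τ) (deriv (X k) σ))), Y k σ⟫)) = ∑ k, ∑ j, cc k * (∫ σ in {σ : ℝ | ‖X k σ‖ ≤ ℓ}, ⟪(∫ τ in {σ : ℝ | ‖X j σ‖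 ≤ ℓ}, ((3 * ((‖X j τ - X k σ‖ ^ 2 + m k σ) ^ (5 / 2 : ℝ))⁻¹ * ⟪(ψ j τ - ⟪ψ j τ, deriv (X j) τ⟫ • deriv (X j) τ), cross (deriv (X k) σ) (X j τ - X k σ)⟫) • (X j τ - X k σ) - ((‖X j τ - X k σ‖ ^ 2 + m k σ) ^ (3 / 2 : ℝ))⁻¹ • cross (ψ j τ - ⟪ψ j τ, deriv (X j) τ⟫ • deriv (X j) τ) (deriv (X k) σ))), Y k σ⟫) := Finset.sum_comm
  have hcomm2 : (∑ j, ∑ k, cc k * (∫ σ in {σ : ℝ | ‖X k σ‖ ≤ ℓ}, ⟪(∫ τ in {σ : ℝ | ‖X j σ‖ ≤ ℓ}, ((3 * ⟪X j τ - X k σ, deriv (X k) σ⟫ * ((‖X j τ - X k σ‖ ^ 2 + a₀ k) ^ (5 / 2 : ℝ))⁻¹) • cross (ψ j τ - ⟪ψ j τ, deriv (X j) τ⟫ • deriv (X j) τ) (X k σ - X j τ) + ((‖X j τ - X k σ‖ ^ 2 + a₀ k) ^ (3 / 2 : ℝ))⁻¹ • cross (ψ j τ - ⟪ψ j τ, deriv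 (X j) τ⟫ • deriv (X j) τ) (deriv (X k) σ))), Y k σ⟫)) = ∑ k, ∑ j, cc k * (∫ σ in {σ : ℝ | ‖X k σ‖ ≤ ℓ}, ⟪(∫ τ in {σ : ℝ | ‖X j σ‖ ≤ ℓ}, ((3 * ⟪X j τ - X k σ, deriv (X k) σ⟫ * ((‖X j τ - X k σ‖ ^ 2 + a₀ k) ^ (5 / 2 : ℝ))⁻¹) • cross (ψ j τ - ⟪ψ j τ, deriv (X j) τ⟫ • deriv (X j) τ) (X k σ - X j τ) + ((‖X j τ - X k σ‖ ^ 2 + a₀ k) ^ (3 / 2 : ℝ))⁻¹ • cross (ψ j τ - ⟪ψ j τ, deriv (X j) τ⟫ • deriv (X j) τ) (deriv (X k) σ))), Y k σ⟫) := Finset.sum_comm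
  rw [hcomm1, hcomm2]
  ring

/-- **COROLLARY (the target equation of census item (c)).**  If the adjoint weights vanish on the balls — `(D^*ψ)_k(σ) = 0` for `σ ∈ S_k` — then the
pairing `Σ_j ∫_{S_j} ⟪ψ_j, E_j⟫` vanishes for the given clamped test family. [folklore] -/
theorem annihilation_of_adjoint_eq_zero {N : ℕ} {ℓ Λ α m₀ c C : ℝ} {X ψ Y : Fin N → ℝ → EuclideanSpace ℝ (Fin 3)} {w : Fin N → ℝ → ℝ}
    {m : Fin N → ℝ → ℝ} {a₀ : Fin N → ℝ} {U : Fin N → Set ℝ} (cc : Fin N → ℝ)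
    (hX : ∀ j, ContDiff ℝ 2 (X j)) (hX1 : ∀ k σ, ‖deriv (X k) σ‖ ≤ 1) (hc : 0 < c) (hXg : ∀ k σ, c * |σ| - C ≤ ‖X k σ‖)
    (hS : ∀ j, IsCompact {σ : ℝ | ‖X j σ‖ ≤ ℓ}) (hw : ∀ j, Differentiable ℝ (w j)) (hwΛ : ∀ j τ, |deriv (w j) τ| ≤ Λ)
    (hψ : ∀ j, ContDiff ℝ 1 (ψ j)) (hY : ∀ k, ContDiff ℝ 1 (Y k)) (hYoff : ∀ k τ, ℓ < ‖X k τ‖ → Y k τ = 0)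
    (hm₀ : 0 < m₀) (hm : ∀ k σ, m₀ ≤ m k σ) (hmc : ∀ k, Continuous (m k)) (ha₀ : ∀ k, 0 < a₀ k) (hU : ∀ k, IsOpen (U k))
    (hmU : ∀ k σ, σ ∈ U k → m k σ = a₀ k) (hYU : ∀ k, tsupport (Y k) ⊆ U k)
    (hzero : ∀ k, ∀ σ ∈ {σ : ℝ | ‖X k σ‖ ≤ ℓ}, ((∑ k', cc k' • (∫ u, ((-3 * ((‖X k σ - X k' u‖ ^ 2 + m k' u) ^ (5 / 2 : ℝ))⁻¹ * ⟪(ψ k σ - ⟪ψ k σ, deriv (X k) σ⟫ • deriv (X k) σ), cross (deriv (X k') u) (X k σ - X k' u)⟫) • (X k σ - X k' u) + ((‖X k σ - X k' u‖ ^ 2 + m k' u) ^ (3 / 2 : ℝ))⁻¹ • cross (ψ k σ - ⟪ψ k σ, deriv (X k) σ⟫ • deriv (X k) σ) (deriv (X k') u)))) + (∑ j, cc k • ((∫ τ in {σ : ℝ | ‖X j σ‖ ≤ ℓ}, ((3 * ((‖X j τ - X k σ‖ ^ 2 + m k σ) ^ (5 / 2 : ℝ))⁻¹ * ⟪(ψ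 j τ - ⟪ψ j τ, deriv (X j) τ⟫ • deriv (X j) τ), cross (deriv (X k) σ) (X j τ - X k σ)⟫) • (X j τ - X k σ) - ((‖X j τ - X k σ‖ ^ 2 + m k σ) ^ (3 / 2 : ℝ))⁻¹ • cross (ψ j τ - ⟪ψ j τ, deriv (X j) τ⟫ • deriv (X j) τ) (deriv (X k) σ))) - (∫ τ in {σ : ℝ | ‖X j σ‖ ≤ ℓ}, ((3 * ⟪X j τ - X k σ, deriv (X k) σ⟫ * ((‖X j τ - X k σ‖ ^ 2 + a₀ k) ^ (5 / 2 : ℝ))⁻¹) • cross (ψ j τ - ⟪ψ j τ, deriv (X j) τ⟫ • deriv (X j) τ) (X k σ - X j τ) + ((‖X j τ - X k σ‖ ^ 2 + a₀ k) ^ (3 / 2 : ℝ))⁻¹ • cross (ψ j τ - ⟪ψ j τ, deriv (X j) τ⟫ • deriv (X j) τ) (deriv (X k) σ))))) + ((1 / 2 : ℝ) • (ψ k σ - ⟪ψ k σ, deriv (X k) σ⟫ • deriv (X k) σ) + α • cross (EuclideanSpace.single 2 1) (ψ k σ - ⟪ψ k σ, deriv (X k) σ⟫ • deriv (X k) σ))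 + (deriv (w k) σ • (ψ k σ - ⟪ψ k σ, deriv (X k) σ⟫ • deriv (X k) σ) + w k σ • (deriv (ψ k) σ - (⟪deriv (ψ k) σ, deriv (X k) σ⟫ + ⟪ψ k σ, deriv (deriv (X k)) σ⟫) • deriv (X k) σ - ⟪ψ k σ, deriv (X k) σ⟫ • deriv (deriv (X k)) σ))) = 0) :
    ∑ j, ∫ τ in {σ : ℝ | ‖X j σ‖ ≤ ℓ}, ⟪ψ j τ, (((∑ k, cc k • ∫ σ, ((-3 * ⟪X j τ - X k σ, Y j τ - Y k σ⟫ * ((‖X j τ - X k σ‖ ^ 2 + m k σ) ^ (5 / 2 : ℝ))⁻¹) • cross (deriv (X k) σ) (X j τ - X k σ) + ((‖X j τ - X k σ‖ ^ 2 + m k σ) ^ (3 / 2 : ℝ))⁻¹ • (cross (deriv (X k) σ) (Y j τ - Y k σ) + cross (deriv (Y k) σ) (X j τ - X k σ)))) + (1 / 2 : ℝ) • Y j τ - α • cross (EuclideanSpace.single 2 1) (Y j τ)) - ⟪((∑ k, cc k • ∫ σ, ((-3 * ⟪X j τ - X k σ, Y j τ - Y k σ⟫ * ((‖X j τ - X k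 σ‖ ^ 2 + m k σ) ^ (5 / 2 : ℝ))⁻¹) • cross (deriv (X k) σ) (X j τ - X k σ) + ((‖X j τ - X k σ‖ ^ 2 + m k σ) ^ (3 / 2 : ℝ))⁻¹ • (cross (deriv (X k) σ) (Y j τ - Y k σ) + cross (deriv (Y k) σ) (X j τ - X k σ)))) + (1 / 2 : ℝ) • Y j τ - α • cross (EuclideanSpace.single 2 1) (Y j τ)), deriv (X j) τ⟫ • deriv (X j) τ + ((w j τ * ⟪deriv (X j) τ, deriv (Y j) τ⟫) • deriv (X j) τ - w j τ • deriv (Y j) τ))⟫ = 0 := by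
  rw [adjoint_pairing_identity cc hX hX1 hc hXg hS hw hwΛ hψ hY hYoff hm₀ hm hmc ha₀ hU hmU hYU]
  refine Finset.sum_eq_zero fun k _ => ?_
  refine setIntegral_eq_zero_of_forall_eq_zero fun σ hσ => ?_
  rw [hzero k σ hσ, inner_zero_left]

end Summit.NavierStokesRegularity.NavierStokesRegularity.Theorems.Clause13RAdjointOperator

end
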